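import Summits.Parity.GeneralizedHardyLittlewood.Theses.ConstellationCubes
import Summits.Parity.GeneralizedHardyLittlewood.Theorems.ConstellationCubesDefs
import Literature.NumberTheory.Sieve.LinearEquationsInPrimesLocalObstruction
import Literature.NumberTheory.Sieve.LinearEquationsInPrimesSubsystems
import Literature.NumberTheory.Sieve.LinearEquationsInPrimesPseudorandom
import Literature.NumberTheory.Sieve.GeneralizedHardyLittlewoodParityBoundary

/-!
# Route `ConstellationCubes`, glue item `CubeHLGlue` (stmt-Parity-30021): `OneClassHL → RelCube → CubeHL`

Proof of the glue of the rev-2 split of the declared residual `CubeHL` (stmt-Parity-28872) into `OneClassHL`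
(stmt-Parity-30019) and `RelCube` (stmt-Parity-30020) — node G1.2.F.1 «RelativeCubes» of the decomp-parity cell
(lens-4 g5; critic CLEARED STATUS l.248, CRITIC-LEDGER row 52; filed as route-Parity-ConstellationCubes REV 2,
STATUS l.256, HAND WANTED).  The mathematics is lens-4's cell kernel `RelativeCubes.lean` (@5e250a400e2986d6)
verbatim, re-namespaced, with the readable vocabulary moved to `Theorems/ConstellationCubesDefs.lean` and every
statement made ON THE BORN DECLS:

* necessity `oneClassHL_of_cubeHL`, `relCube_of_cubeHL` (restriction / densities `ρ ≡ 1`);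
* the glue `cubeHL_of_pieces` = real arithmetic: the class clauses pin `|ρ_ω − 1|·β_∞(Ψ_ω,K)𝔖(Ψ_ω) ≤ 2εN^d`,
  `β_∞(Ψ,K) ≤ β_∞(Ψ_ω,K)`, `𝔖(Ψ) > 0 ⇒ 𝔖(Ψ_ω) > 0`, `|∏ρ_ω − 1| ≤ R'^#V Σ|ρ_ω − 1|`; the case `𝔖(Ψ) = 0`
  is the full clause itself;
* `cubeHLGlue_holds : CubeHLGlue` (the item), `node_iff : CubeHL ↔ OneClassHL ∧ RelCube` (exactness),
  `cubeHL_of_ghl` / `pieces_of_ghl` (necessity from the conjunct).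

0 sorry · axioms propext / Classical.choice / Quot.sound.
-/

namespace Summit.Parity.GeneralizedHardyLittlewood.ConstellationCubesCubeHLGlue

open scoped BigOperators Classical
open Literature.NumberTheory.Sieve Finset MeasureTheory
open Summit.Parity.GeneralizedHardyLittlewood.Theses.ConstellationCubes (CubeHL OneClassHL RelCube CubeHLGlue)

variable {d t : ℕ}

/-- The parent item BY NAME is `∀ …, IsCube Ψ → HLFor Ψ`. -/
theorem cubeHL_iff : CubeHL ↔
    (∀ (d t : ℕ), 1 ≤ d → 1 ≤ t → ∀ Ψ : Fin t → AffLinForm d, IsNondegenerateSystem Ψ → IsCube Ψ → HLFor Ψ) :=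
  Iff.rfl

/-- The born `OneClassHL` (30019) in readable form. -/
theorem oneClassHL_iff : OneClassHL ↔
    (∀ (d t : ℕ), 1 ≤ d → 1 ≤ t → ∀ Ψ : Fin t → AffLinForm d, IsNondegenerateSystem Ψ → IsCube Ψ →
      (∀ i i' : Fin t, ∀ j : Fin d, (Ψ i).coeff j = 0 ↔ (Ψ i').coeff j = 0) → HLFor Ψ) :=
  Iff.rfl

/-- The born `RelCube` (30020) in readable form (`vertices`, `sub` of the Defs file). -/
theorem relCube_iff : RelCube ↔
    (∀ (d t : ℕ), 1 ≤ d → 1 ≤ t → ∀ Ψ : Fin t → AffLinForm d, IsNondegenerateSystem Ψ → IsCube Ψ →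
      ∃ R : ℝ, ∀ ε : ℝ, 0 < ε → ∃ N₀ : ℕ, ∀ N : ℕ, N₀ ≤ N → ∃ ρ : (Fin d → ℤ) → ℝ,
        (∀ ω, 0 ≤ ρ ω ∧ ρ ω ≤ R) ∧
        (∀ K : Set (Fin d → ℝ), Convex ℝ K → K ⊆ realBox d N →
          |vonMangoldtSum Ψ K N - (∏ ω ∈ vertices Ψ, ρ ω) * (archFactor Ψ K * singularProduct Ψ)| ≤
            ε * (N : ℝ) ^ d) ∧
        (∀ ω ∈ vertices Ψ, ∀ K : Set (Fin d → ℝ), Convex ℝ K → K ⊆ realBox d N →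
          |vonMangoldtSum (sub Ψ ω) K N - ρ ω * (archFactor (sub Ψ ω) K * singularProduct (sub Ψ ω))| ≤
            ε * (N : ℝ) ^ d)) :=
  Iff.rfl

/-! ## Structural lemmas: vertices, classes, class sub-systems -/

/-- Membership in a class is having that support pattern. -/
theorem mem_cls {Ψ : Fin t → AffLinForm d} {ω : Fin d → ℤ} {i : Fin t} : i ∈ cls Ψ ω ↔ vtx Ψ i = ω := by
  simp [cls]

/-- The re-indexing map of a class lands in the class. -/
theorem vtx_sub_index (Ψ : Fin t → AffLinForm d) (ω : Fin d → ℤ) (k : Fin (cls Ψ ω).card) :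
    vtx Ψ ((cls Ψ ω).orderEmbOfFin rfl k) = ω :=
  mem_cls.mp (Finset.orderEmbOfFin_mem (cls Ψ ω) rfl k)

/-- A vertex that occurs has a non-empty class. -/
theorem card_cls_pos {Ψ : Fin t → AffLinForm d} {ω : Fin d → ℤ} (hω : ω ∈ vertices Ψ) :
    1 ≤ (cls Ψ ω).card := by
  obtain ⟨i, -, hi⟩ := Finset.mem_image.mp hω
  exact Finset.card_pos.mpr ⟨i, mem_cls.mpr hi⟩

/-- The vertex of form `i` occurs. -/
theorem vtx_mem_vertices (Ψ : Fin t → AffLinForm d) (i : Fin t) : vtx Ψ i ∈ vertices Ψ :=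
  Finset.mem_image.mpr ⟨i, Finset.mem_univ _, rfl⟩

/-- The vertex set of a system with a form is non-empty. -/
theorem vertices_nonempty (Ψ : Fin t → AffLinForm d) (ht : 1 ≤ t) : (vertices Ψ).Nonempty :=
  ⟨vtx Ψ ⟨0, ht⟩, vtx_mem_vertices Ψ _⟩

/-- A class sub-system of a non-degenerate system is non-degenerate. -/
theorem sub_nondegenerate {Ψ : Fin t → AffLinForm d} (hΨ : IsNondegenerateSystem Ψ) (ω : Fin d → ℤ) :
    IsNondegenerateSystem (sub Ψ ω) := by
  refine ⟨fun k => hΨ.1 _, fun k k' hkk' a b hab => hΨ.2 _ _ ?_ a b hab⟩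
  exact fun h => hkk' (((cls Ψ ω).orderEmbOfFin rfl).injective h)

/-- A class sub-system of a cube system is a cube system. -/
theorem sub_isCube {Ψ : Fin t → AffLinForm d} (hΨ : IsCube Ψ) (ω : Fin d → ℤ) : IsCube (sub Ψ ω) :=
  fun _ => hΨ _

/-- All forms of a class sub-system have the same support. -/
theorem sub_sameSupport (Ψ : Fin t → AffLinForm d) (ω : Fin d → ℤ) :
    ∀ k k' : Fin (cls Ψ ω).card, ∀ j : Fin d, (sub Ψ ω k).coeff j = 0 ↔ (sub Ψ ω k').coeff j = 0 := by
  intro k k' j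
  have hk := congr_fun (vtx_sub_index Ψ ω k) j
  have hk' := congr_fun (vtx_sub_index Ψ ω k') j
  simp only [vtx] at hk hk'
  show (Ψ ((cls Ψ ω).orderEmbOfFin rfl k)).coeff j = 0 ↔ (Ψ ((cls Ψ ω).orderEmbOfFin rfl k')).coeff j = 0
  constructor
  · intro h1
    by_contra h2
    rw [if_pos h1] at hk
    rw [if_neg h2] at hk'
    omega
  · intro h2
    by_contra h1
    rw [if_neg h1] at hk
    rw [if_pos h2] at hk'
    omega

/-- In a system whose forms all have the same support there is exactly one vertex. -/
theorem vertices_eq_singleton_of_sameSupport {Ψ : Fin t → AffLinForm d} (ht : 1 ≤ t)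
    (hs : ∀ i i' : Fin t, ∀ j : Fin d, (Ψ i).coeff j = 0 ↔ (Ψ i').coeff j = 0) :
    vertices Ψ = {vtx Ψ ⟨0, ht⟩} := by
  refine Finset.eq_singleton_iff_unique_mem.mpr ⟨vtx_mem_vertices Ψ _, fun ω hω => ?_⟩
  obtain ⟨i, -, rfl⟩ := Finset.mem_image.mp hω
  funext j
  simp only [vtx]
  by_cases h1 : (Ψ i).coeff j = 0
  · have h2 : (Ψ ⟨0, ht⟩).coeff j = 0 := (hs i ⟨0, ht⟩ j).mp h1
    rw [if_pos h1, if_pos h2]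
  · have h2 : ¬ (Ψ ⟨0, ht⟩).coeff j = 0 := fun h => h1 ((hs i ⟨0, ht⟩ j).mpr h)
    rw [if_neg h1, if_neg h2]

/-! ## Necessity: both pieces follow from the parent `CubeHL` (hypothesis-free) -/

/-- NECESSITY 1: `CubeHL → OneClassHL` (restriction to the one-class sub-family). -/
theorem oneClassHL_of_cubeHL : CubeHL → OneClassHL :=
  fun h d t hd ht Ψ hΨ hc _ => h d t hd ht Ψ hΨ hc

/-- NECESSITY 2: `CubeHL → RelCube` (take every density `ρ_ω = 1`, cap `R = 1`). -/
theorem relCube_of_cubeHL : CubeHL → RelCube := by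
  rw [relCube_iff]
  intro h d t hd ht Ψ hΨ hc
  refine ⟨1, fun ε hε => ?_⟩
  -- the parent for Ψ itself
  obtain ⟨N₁, hN₁⟩ := h d t hd ht Ψ hΨ hc ε hε
  -- the parent for every class sub-system
  have hcl : ∀ ω ∈ vertices Ψ, ∃ Nω : ℕ, ∀ N : ℕ, Nω ≤ N → ∀ K : Set (Fin d → ℝ), Convex ℝ K →
      K ⊆ realBox d N →
        |vonMangoldtSum (sub Ψ ω) K N - archFactor (sub Ψ ω) K * singularProduct (sub Ψ ω)| ≤
          ε * (N : ℝ) ^ d :=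
    fun ω hω => h d _ hd (card_cls_pos hω) (sub Ψ ω) (sub_nondegenerate hΨ ω) (sub_isCube hc ω) ε hε
  choose! Nω hNω using hcl
  refine ⟨max N₁ ((vertices Ψ).sup Nω), fun N hN => ⟨fun _ => 1, fun _ => ⟨zero_le_one, le_rfl⟩, ?_, ?_⟩⟩
  · intro K hK hKN
    simpa using hN₁ N (le_trans (le_max_left _ _) hN) K hK hKN
  · intro ω hω K hK hKN
    have hle : Nω ω ≤ N := le_trans (Finset.le_sup hω) (le_trans (le_max_right _ _) hN)
    simpa using hNω ω hω N hle K hK hKN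


/-! ## Analytic lemmas for the glue -/

/-- Fewer positivity constraints, larger archimedean factor: `β_∞(Ψ, K) ≤ β_∞(Ψ_ω, K)` for bounded `K`. -/
theorem archFactor_le_sub (Ψ : Fin t → AffLinForm d) (ω : Fin d → ℤ) {K : Set (Fin d → ℝ)} {N : ℕ}
    (hKN : K ⊆ realBox d N) : archFactor Ψ K ≤ archFactor (sub Ψ ω) K := by
  unfold archFactor
  have hsub : K ∩ {x | ∀ i, 0 < (Ψ i).realEval x} ⊆ K ∩ {x | ∀ k, 0 < (sub Ψ ω k).realEval x} :=
    fun x hx => ⟨hx.1, fun k => hx.2 _⟩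
  have hfin : volume (K ∩ {x | ∀ k, 0 < (sub Ψ ω k).realEval x}) ≠ ⊤ := by
    refine ne_top_of_le_ne_top ?_ (measure_mono (Set.inter_subset_left.trans hKN))
    exact (isCompact_Icc.measure_lt_top (μ := volume)).ne
  exact ENNReal.toReal_mono hfin (measure_mono hsub)

/-- A residue good for every form of `Ψ` is good for every form of a class: `β_p(Ψ) > 0 ⇒ β_p(Ψ_ω) > 0`. -/
theorem localFactor_sub_pos (Ψ : Fin t → AffLinForm d) (ω : Fin d → ℤ) {p : ℕ} (hp : p.Prime)
    (hβ : 0 < localFactor Ψ p) : 0 < localFactor (sub Ψ ω) p := by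
  unfold localFactor at hβ ⊢
  have hpd : (0 : ℝ) < ((p : ℝ) ^ d)⁻¹ := by
    have : (0 : ℝ) < (p : ℝ) := by exact_mod_cast hp.pos
    positivity
  have hS : (0 : ℝ) < ∑ n ∈ Fintype.piFinset (fun _ : Fin d => range p),
      ∏ i, localVonMangoldt p ((Ψ i).eval fun j => (n j : ℤ)) :=
    (mul_pos_iff_of_pos_left hpd).mp hβ
  have hS' : ∑ n ∈ Fintype.piFinset (fun _ : Fin d => range p), (0 : ℝ) <
      ∑ n ∈ Fintype.piFinset (fun _ : Fin d => range p),
        ∏ i, localVonMangoldt p ((Ψ i).eval fun j => (n j : ℤ)) := by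
    simpa using hS
  obtain ⟨n, hn, hpos⟩ := Finset.exists_lt_of_sum_lt hS'
  -- every factor of the positive product is positive
  have hfac : ∀ i, 0 < localVonMangoldt p ((Ψ i).eval fun j => (n j : ℤ)) := by
    intro i
    refine (localVonMangoldt_nonneg _ _).lt_of_ne fun h0 => ?_
    have := Finset.prod_eq_zero (f := fun i => localVonMangoldt p ((Ψ i).eval fun j => (n j : ℤ)))
      (Finset.mem_univ i) h0.symm
    rw [this] at hpos
    exact lt_irrefl _ hpos
  have hsubpos : 0 < ∏ k, localVonMangoldt p ((sub Ψ ω k).eval fun j => (n j : ℤ)) :=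
    Finset.prod_pos fun k _ => hfac _
  have hle : ∏ k, localVonMangoldt p ((sub Ψ ω k).eval fun j => (n j : ℤ)) ≤
      ∑ n ∈ Fintype.piFinset (fun _ : Fin d => range p),
        ∏ k, localVonMangoldt p ((sub Ψ ω k).eval fun j => (n j : ℤ)) :=
    Finset.single_le_sum (f := fun n : Fin d → ℕ => ∏ k, localVonMangoldt p ((sub Ψ ω k).eval fun j => (n j : ℤ)))
      (fun m _ => Finset.prod_nonneg fun k _ => localVonMangoldt_nonneg _ _) hn
  exact lt_of_lt_of_le (mul_pos hpd hsubpos) (mul_le_mul_of_nonneg_left hle hpd.le)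

/-- `𝔖(Ψ) ≠ 0 ⇒ 𝔖(Ψ_ω) > 0` (no local obstruction for `Ψ` ⇒ none for a class). -/
theorem singularProduct_sub_pos {Ψ : Fin t → AffLinForm d} (hΨ : IsNondegenerateSystem Ψ)
    (hS : singularProduct Ψ ≠ 0) (ω : Fin d → ℤ) : 0 < singularProduct (sub Ψ ω) := by
  refine singularProduct_pos_of_localFactor_pos _ (sub_nondegenerate hΨ ω) fun p hp => ?_
  refine localFactor_sub_pos Ψ ω hp ((localFactor_nonneg Ψ p).lt_of_ne fun h0 => ?_)
  exact hS (singularProduct_eq_zero_of_localFactor_eq_zero Ψ hΨ hp h0.symm)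

/-- Telescoping: `|∏_s ρ − 1| ≤ R^{#s} Σ_s |ρ − 1|` for `0 ≤ ρ ≤ R`, `R ≥ 1`. -/
theorem abs_prod_sub_one_le {ι : Type*} (s : Finset ι) (ρ : ι → ℝ) (R : ℝ) (hR : 1 ≤ R)
    (hρ : ∀ i ∈ s, 0 ≤ ρ i ∧ ρ i ≤ R) :
    |∏ i ∈ s, ρ i - 1| ≤ R ^ s.card * ∑ i ∈ s, |ρ i - 1| := by
  induction s using Finset.induction_on with
  | empty => simp
  | insert a s ha ih =>
    rw [Finset.prod_insert ha, Finset.sum_insert ha, Finset.card_insert_of_notMem ha]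
    have hρa := hρ a (Finset.mem_insert_self a s)
    have ih' := ih fun i hi => hρ i (Finset.mem_insert_of_mem hi)
    have hsum : 0 ≤ ∑ i ∈ s, |ρ i - 1| := Finset.sum_nonneg fun _ _ => abs_nonneg _
    have hRpow : 1 ≤ R ^ s.card := one_le_pow₀ hR
    have hR0 : 0 ≤ R := zero_le_one.trans hR
    have e : ρ a * ∏ i ∈ s, ρ i - 1 = ρ a * (∏ i ∈ s, ρ i - 1) + (ρ a - 1) := by ring
    rw [e]
    calc |ρ a * (∏ i ∈ s, ρ i - 1) + (ρ a - 1)|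
        ≤ |ρ a * (∏ i ∈ s, ρ i - 1)| + |ρ a - 1| := abs_add_le _ _
      _ = ρ a * |∏ i ∈ s, ρ i - 1| + |ρ a - 1| := by rw [abs_mul, abs_of_nonneg hρa.1]
      _ ≤ R * (R ^ s.card * ∑ i ∈ s, |ρ i - 1|) + R ^ s.card * R * |ρ a - 1| := by
          have h1 : ρ a * |∏ i ∈ s, ρ i - 1| ≤ R * (R ^ s.card * ∑ i ∈ s, |ρ i - 1|) :=
            mul_le_mul hρa.2 ih' (abs_nonneg _) hR0
          have h2 : |ρ a - 1| ≤ R ^ s.card * R * |ρ a - 1| :=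
            le_mul_of_one_le_left (abs_nonneg _) (one_le_mul_of_one_le_of_one_le hRpow hR)
          linarith
      _ = R ^ (s.card + 1) * (|ρ a - 1| + ∑ i ∈ s, |ρ i - 1|) := by ring

/-! ## Sufficiency: the glue `OneClassHL → RelCube → CubeHL` (PROVED) -/

/-- GLUE (the split's glue item, proved): fibred k-tuple HL plus density-blind cube statistics give
cube-system HL. -/
theorem cubeHL_of_pieces (h1 : OneClassHL) (hR : RelCube) : CubeHL := by
  rw [oneClassHL_iff] at h1
  rw [relCube_iff] at hR
  rw [cubeHL_iff]
  intro d t hd ht Ψ hΨ hc ε hε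
  obtain ⟨R, hRε⟩ := hR d t hd ht Ψ hΨ hc
  have hS0 : 0 ≤ singularProduct Ψ := GHLParityBoundary.singularProduct_nonneg_of_isNondegenerateSystem hΨ
  have hSω0 : ∀ ω, 0 ≤ singularProduct (sub Ψ ω) := fun ω =>
    GHLParityBoundary.singularProduct_nonneg_of_isNondegenerateSystem (sub_nondegenerate hΨ ω)
  obtain ⟨R', hR'⟩ : ∃ R' : ℝ, R' = max R 1 := ⟨_, rfl⟩
  have hR'1 : 1 ≤ R' := hR' ▸ le_max_right _ _
  have hRR' : R ≤ R' := hR' ▸ le_max_left _ _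
  have hsum0 : 0 ≤ ∑ ω ∈ vertices Ψ, singularProduct Ψ / singularProduct (sub Ψ ω) :=
    Finset.sum_nonneg fun ω _ => div_nonneg hS0 (hSω0 ω)
  obtain ⟨C, hC⟩ : ∃ C : ℝ,
      C = 2 * R' ^ (vertices Ψ).card * ∑ ω ∈ vertices Ψ, singularProduct Ψ / singularProduct (sub Ψ ω) :=
    ⟨_, rfl⟩
  have hC0 : 0 ≤ C := by
    rw [hC]
    exact mul_nonneg (mul_nonneg zero_le_two (pow_nonneg (zero_le_one.trans hR'1) _)) hsum0
  obtain ⟨ε₁, hε₁d⟩ : ∃ ε₁ : ℝ, ε₁ = ε / (1 + C) := ⟨_, rfl⟩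
  have hε₁ : 0 < ε₁ := hε₁d ▸ div_pos hε (by linarith)
  have hε₁C : (1 + C) * ε₁ = ε := by
    rw [hε₁d]; field_simp
  have hε₁ε : ε₁ ≤ ε := hε₁d ▸ div_le_self hε.le (by linarith)
  obtain ⟨N₁, hN₁⟩ := hRε ε₁ hε₁
  have hcl : ∀ ω ∈ vertices Ψ, ∃ Nω : ℕ, ∀ N : ℕ, Nω ≤ N → ∀ K : Set (Fin d → ℝ), Convex ℝ K →
      K ⊆ realBox d N →
        |vonMangoldtSum (sub Ψ ω) K N - archFactor (sub Ψ ω) K * singularProduct (sub Ψ ω)| ≤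
          ε₁ * (N : ℝ) ^ d :=
    fun ω hω => h1 d _ hd (card_cls_pos hω) (sub Ψ ω) (sub_nondegenerate hΨ ω) (sub_isCube hc ω)
      (sub_sameSupport Ψ ω) ε₁ hε₁
  choose! Nω hNω using hcl
  refine ⟨max N₁ ((vertices Ψ).sup Nω), fun N hN K hK hKN => ?_⟩
  obtain ⟨ρ, hρb, hfull, hclass⟩ := hN₁ N (le_trans (le_max_left _ _) hN)
  have hNd : (0 : ℝ) ≤ (N : ℝ) ^ d := by positivity
  have hfullK := hfull K hK hKN
  by_cases hS : singularProduct Ψ = 0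
  · -- no main term: the full clause is the claim
    rw [hS, mul_zero, mul_zero, sub_zero] at hfullK
    rw [hS, mul_zero, sub_zero]
    exact hfullK.trans (mul_le_mul_of_nonneg_right hε₁ε hNd)
  · have hSωpos : ∀ ω, 0 < singularProduct (sub Ψ ω) := fun ω => singularProduct_sub_pos hΨ hS ω
    -- per-class: the class count pins ρ_ω
    have hdev : ∀ ω ∈ vertices Ψ,
        |ρ ω - 1| * (archFactor (sub Ψ ω) K * singularProduct (sub Ψ ω)) ≤ 2 * (ε₁ * (N : ℝ) ^ d) := by
      intro ω hω
      have ha := hNω ω hω N (le_trans (Finset.le_sup hω) (le_trans (le_max_right _ _) hN)) K hK hKN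
      have hb := hclass ω hω K hK hKN
      have hM : 0 ≤ archFactor (sub Ψ ω) K * singularProduct (sub Ψ ω) :=
        mul_nonneg (archFactor_nonneg _ _) (hSω0 ω)
      rw [← abs_of_nonneg hM, ← abs_mul]
      have e : (ρ ω - 1) * (archFactor (sub Ψ ω) K * singularProduct (sub Ψ ω)) =
          (vonMangoldtSum (sub Ψ ω) K N - archFactor (sub Ψ ω) K * singularProduct (sub Ψ ω)) -
          (vonMangoldtSum (sub Ψ ω) K N - ρ ω * (archFactor (sub Ψ ω) K * singularProduct (sub Ψ ω))) := by
        ring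
      rw [e]
      exact (abs_sub _ _).trans (by linarith)
    -- telescoping over the vertices
    have hP : |∏ ω ∈ vertices Ψ, ρ ω - 1| ≤ R' ^ (vertices Ψ).card * ∑ ω ∈ vertices Ψ, |ρ ω - 1| :=
      abs_prod_sub_one_le _ ρ R' hR'1 fun ω _ => ⟨(hρb ω).1, (hρb ω).2.trans hRR'⟩
    -- each vertex term against the full main term
    have hterm : ∀ ω ∈ vertices Ψ, |ρ ω - 1| * (archFactor Ψ K * singularProduct Ψ) ≤
        singularProduct Ψ / singularProduct (sub Ψ ω) * (2 * (ε₁ * (N : ℝ) ^ d)) := by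
      intro ω hω
      have hA := archFactor_le_sub Ψ ω hKN
      have hSωne : singularProduct (sub Ψ ω) ≠ 0 := (hSωpos ω).ne'
      have hq : 0 ≤ singularProduct Ψ / singularProduct (sub Ψ ω) := div_nonneg hS0 (hSω0 ω)
      calc |ρ ω - 1| * (archFactor Ψ K * singularProduct Ψ)
          = singularProduct Ψ / singularProduct (sub Ψ ω) *
              (|ρ ω - 1| * (archFactor Ψ K * singularProduct (sub Ψ ω))) := by
            rw [div_mul_eq_mul_div, eq_div_iff hSωne]; ring
        _ ≤ singularProduct Ψ / singularProduct (sub Ψ ω) *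
              (|ρ ω - 1| * (archFactor (sub Ψ ω) K * singularProduct (sub Ψ ω))) := by
            apply mul_le_mul_of_nonneg_left _ hq
            apply mul_le_mul_of_nonneg_left _ (abs_nonneg _)
            exact mul_le_mul_of_nonneg_right hA (hSω0 ω)
        _ ≤ singularProduct Ψ / singularProduct (sub Ψ ω) * (2 * (ε₁ * (N : ℝ) ^ d)) :=
            mul_le_mul_of_nonneg_left (hdev ω hω) hq
    have hAS : 0 ≤ archFactor Ψ K * singularProduct Ψ := mul_nonneg (archFactor_nonneg _ _) hS0
    have hmain : |(∏ ω ∈ vertices Ψ, ρ ω) - 1| * (archFactor Ψ K * singularProduct Ψ) ≤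
        C * (ε₁ * (N : ℝ) ^ d) := by
      calc |(∏ ω ∈ vertices Ψ, ρ ω) - 1| * (archFactor Ψ K * singularProduct Ψ)
          ≤ (R' ^ (vertices Ψ).card * ∑ ω ∈ vertices Ψ, |ρ ω - 1|) *
              (archFactor Ψ K * singularProduct Ψ) := mul_le_mul_of_nonneg_right hP hAS
        _ = R' ^ (vertices Ψ).card *
              ∑ ω ∈ vertices Ψ, |ρ ω - 1| * (archFactor Ψ K * singularProduct Ψ) := by
            rw [mul_assoc, Finset.sum_mul]
        _ ≤ R' ^ (vertices Ψ).card *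
              ∑ ω ∈ vertices Ψ, singularProduct Ψ / singularProduct (sub Ψ ω) * (2 * (ε₁ * (N : ℝ) ^ d)) :=
            mul_le_mul_of_nonneg_left (Finset.sum_le_sum hterm) (pow_nonneg (zero_le_one.trans hR'1) _)
        _ = C * (ε₁ * (N : ℝ) ^ d) := by
            rw [hC, ← Finset.sum_mul]; ring
    have e : vonMangoldtSum Ψ K N - archFactor Ψ K * singularProduct Ψ =
        (vonMangoldtSum Ψ K N - (∏ ω ∈ vertices Ψ, ρ ω) * (archFactor Ψ K * singularProduct Ψ)) +
          ((∏ ω ∈ vertices Ψ, ρ ω) - 1) * (archFactor Ψ K * singularProduct Ψ) := by ring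
    rw [e]
    calc |(vonMangoldtSum Ψ K N - (∏ ω ∈ vertices Ψ, ρ ω) * (archFactor Ψ K * singularProduct Ψ)) +
            ((∏ ω ∈ vertices Ψ, ρ ω) - 1) * (archFactor Ψ K * singularProduct Ψ)|
        ≤ |vonMangoldtSum Ψ K N - (∏ ω ∈ vertices Ψ, ρ ω) * (archFactor Ψ K * singularProduct Ψ)| +
            |((∏ ω ∈ vertices Ψ, ρ ω) - 1) * (archFactor Ψ K * singularProduct Ψ)| := abs_add_le _ _
      _ ≤ ε₁ * (N : ℝ) ^ d + C * (ε₁ * (N : ℝ) ^ d) := by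
          rw [abs_mul, abs_of_nonneg hAS]
          exact add_le_add hfullK hmain
      _ = ε * (N : ℝ) ^ d := by rw [← hε₁C]; ring

/-! ## Exactness, summit necessity, refined cone -/

/-- EXACTNESS of the node: `CubeHL ⟺ OneClassHL ∧ RelCube`. -/
theorem node_iff : CubeHL ↔ (OneClassHL ∧ RelCube) :=
  ⟨fun h => ⟨oneClassHL_of_cubeHL h, relCube_of_cubeHL h⟩, fun h => cubeHL_of_pieces h.1 h.2⟩

/-- NECESSITY from the summit: `GHL → CubeHL` (a fixed system has bounded size eventually), hence both pieces. -/
theorem cubeHL_of_ghl : _root_.GeneralizedHardyLittlewood → CubeHL := by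
  intro h d t hd ht Ψ hΨ _ ε hε
  obtain ⟨N₀, hN₀⟩ := h d t ⌈affLinSize Ψ 1⌉₊ hd ht ε hε
  refine ⟨max N₀ 1, fun N hN K hK hKN => hN₀ N (le_trans (le_max_left _ _) hN) Ψ hΨ ?_ K hK hKN⟩
  have h1N : (1 : ℝ) ≤ (N : ℝ) := by exact_mod_cast le_trans (le_max_right _ _) hN
  exact (affLinSize_anti Ψ one_pos h1N).trans (Nat.le_ceil _)

/-- Both pieces are necessary for the conjunct `GeneralizedHardyLittlewood`. -/
theorem pieces_of_ghl : _root_.GeneralizedHardyLittlewood → OneClassHL ∧ RelCube :=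
  fun h => node_iff.mp (cubeHL_of_ghl h)

/-- **THE GLUE ITEM** `CubeHLGlue` (stmt-Parity-30021, support, route-Parity-ConstellationCubes rev 2):
`OneClassHL → RelCube → CubeHL`. -/
theorem cubeHLGlue_holds : CubeHLGlue :=
  fun h1 hR => cubeHL_of_pieces h1 hR

end Summit.Parity.GeneralizedHardyLittlewood.ConstellationCubesCubeHLGlue
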